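import Summits.Ventures.PackingBounds.Configurations.Dim5Card16Unique
import Summits.Ventures.PackingBounds.Configurations.Dim6Card27Unique
import Summits.Ventures.PackingBounds.Configurations.Dim7Card56Unique
import Summits.Ventures.PackingBounds.Configurations.SixHundredCellUnique
import Summits.Ventures.PackingBounds.Configurations.Dim6Card27
import Summits.Ventures.PackingBounds.Configurations.Dim7Card56

/-!
# `A(n, s) = N` with uniqueness: one-statement forms for `(5,16,1/5)`, `(6,27,1/4)`, `(7,56,1/3)` and the 600-cell

Framing: lottery ticket; floor = certified bounds/negative ranges. Venture `PackingBounds` (cell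
`pub-packcert`, seat `pub-packcert-energy`) — summary statements in the shape of `Config.E8Unique.kissing_dim8_unique`:
the optimal value (tree: `…code_isGreatest`, kernel-checked LP certificate + explicit configuration) together with
"any two optimal codes are isometric" (`…Unique.isometric`, gen 9).

## References
* H. Cohn, A. Kumar, J. Amer. Math. Soc. 20 (2007) 99–148, Table 1 and Appendix A. [`CohnKumar2006`]
* E. Bannai, N. J. A. Sloane, Canad. J. Math. 33 (1981) 437–449 (= Conway–Sloane, *SPLAG*, Ch. 14). [`ConwaySloane1999`]
* N. N. Andreev, Russian Math. Surveys 54 (1999) 251–253; P. Boyvalenkov, D. Danev, Arch. Math. 77 (2001) 360–368. [`Andreev1999`]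
-/

noncomputable section

namespace Summit.Ventures.PackingBounds.Config

open Finset

/-- **`A(5, arccos 1/5) = 16` with uniqueness**: `16` is the maximum number of unit vectors of `ℝ⁵` with pairwise inner
products `≤ 1/5`, and any two maximal configurations are isometric (the `D₅` half-cube / Clebsch configuration).
[cite: CohnKumar2006, Appendix A] -/
theorem code_dim5_fifth_unique :
    IsGreatest {N : ℕ | ∃ C : Finset (EuclideanSpace ℝ (Fin 5)),
      C.card = N ∧ (∀ x ∈ C, ‖x‖ = 1) ∧ (∀ x ∈ C, ∀ y ∈ C, x ≠ y → inner ℝ x y ≤ 1 / 5)} 16 ∧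
    ∀ C C' : Finset (EuclideanSpace ℝ (Fin 5)),
      (∀ x ∈ C, ‖x‖ = 1) → (∀ x ∈ C, ∀ y ∈ C, x ≠ y → inner ℝ x y ≤ 1 / 5) → C.card = 16 →
      (∀ x ∈ C', ‖x‖ = 1) → (∀ x ∈ C', ∀ y ∈ C', x ≠ y → inner ℝ x y ≤ 1 / 5) → C'.card = 16 →
      ∃ Ψ : EuclideanSpace ℝ (Fin 5) ≃ₗᵢ[ℝ] EuclideanSpace ℝ (Fin 5), C' = C.image Ψ :=
  ⟨Dim5Card16.code_isGreatest, fun _ _ h1 h2 hN h1' h2' hN' => Dim5Card16Unique.isometric h1 h2 hN h1' h2' hN'⟩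

/-- **`A(6, arccos 1/4) = 27` with uniqueness** (the `E₆` / Schläfli configuration). [cite: CohnKumar2006, Appendix A] -/
theorem code_dim6_quarter_unique :
    IsGreatest {N : ℕ | ∃ C : Finset (EuclideanSpace ℝ (Fin 6)),
      C.card = N ∧ (∀ x ∈ C, ‖x‖ = 1) ∧ (∀ x ∈ C, ∀ y ∈ C, x ≠ y → inner ℝ x y ≤ 1 / 4)} 27 ∧
    ∀ C C' : Finset (EuclideanSpace ℝ (Fin 6)),
      (∀ x ∈ C, ‖x‖ = 1) → (∀ x ∈ C, ∀ y ∈ C, x ≠ y → inner ℝ x y ≤ 1 / 4) → C.card = 27 →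
      (∀ x ∈ C', ‖x‖ = 1) → (∀ x ∈ C', ∀ y ∈ C', x ≠ y → inner ℝ x y ≤ 1 / 4) → C'.card = 27 →
      ∃ Ψ : EuclideanSpace ℝ (Fin 6) ≃ₗᵢ[ℝ] EuclideanSpace ℝ (Fin 6), C' = C.image Ψ :=
  ⟨Dim6Card27.code_isGreatest, fun _ _ h1 h2 hN h1' h2' hN' => Dim6Card27Unique.isometric h1 h2 hN h1' h2' hN'⟩

/-- **`A(7, arccos 1/3) = 56` with uniqueness** (the `E₇` configuration / `28` equiangular lines; Bannai–Sloane).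
[cite: ConwaySloane1999, Ch. 14 Thm. 12] -/
theorem code_dim7_third_unique :
    IsGreatest {N : ℕ | ∃ C : Finset (EuclideanSpace ℝ (Fin 7)),
      C.card = N ∧ (∀ x ∈ C, ‖x‖ = 1) ∧ (∀ x ∈ C, ∀ y ∈ C, x ≠ y → inner ℝ x y ≤ 1 / 3)} 56 ∧
    ∀ C C' : Finset (EuclideanSpace ℝ (Fin 7)),
      (∀ x ∈ C, ‖x‖ = 1) → (∀ x ∈ C, ∀ y ∈ C, x ≠ y → inner ℝ x y ≤ 1 / 3) → C.card = 56 →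
      (∀ x ∈ C', ‖x‖ = 1) → (∀ x ∈ C', ∀ y ∈ C', x ≠ y → inner ℝ x y ≤ 1 / 3) → C'.card = 56 →
      ∃ Ψ : EuclideanSpace ℝ (Fin 7) ≃ₗᵢ[ℝ] EuclideanSpace ℝ (Fin 7), C' = C.image Ψ :=
  ⟨Dim7Card56.code_isGreatest, fun _ _ h1 h2 hN h1' h2' hN' => Dim7Card56Unique.isometric h1 h2 hN h1' h2' hN'⟩

/-- **`A(4, 36°) = 120` with uniqueness**: `120` is the maximum number of unit vectors of `ℝ⁴` with pairwise inner
products `≤ (1+√5)/4` (Andreev), and any two maximal configurations are isometric — the 600-cell is the unique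
optimal code (Boyvalenkov–Danev; Böröczky). [cite: CohnKumar2006, Appendix A] -/
theorem code_dim4_cos36_unique :
    IsGreatest {N : ℕ | ∃ C : Finset (EuclideanSpace ℝ (Fin 4)),
      C.card = N ∧ (∀ x ∈ C, ‖x‖ = 1) ∧ (∀ x ∈ C, ∀ y ∈ C, x ≠ y → inner ℝ x y ≤ (1 + Real.sqrt 5) / 4)} 120 ∧
    ∀ C C' : Finset (EuclideanSpace ℝ (Fin 4)),
      (∀ x ∈ C, ‖x‖ = 1) → (∀ x ∈ C, ∀ y ∈ C, x ≠ y → inner ℝ x y ≤ (1 + Real.sqrt 5) / 4) → C.card = 120 →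
      (∀ x ∈ C', ‖x‖ = 1) → (∀ x ∈ C', ∀ y ∈ C', x ≠ y → inner ℝ x y ≤ (1 + Real.sqrt 5) / 4) →
      C'.card = 120 →
      ∃ Ψ : EuclideanSpace ℝ (Fin 4) ≃ₗᵢ[ℝ] EuclideanSpace ℝ (Fin 4), C' = C.image Ψ :=
  ⟨SixHundredCell.code_isGreatest,
    fun _ _ h1 h2 hN h1' h2' hN' => SixHundredCellCode.isometric h1 h2 hN h1' h2' hN'⟩

end Summit.Ventures.PackingBounds.Config

end
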